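import Mathlib
import HarnessLib

/-!
# Route `RadicialJung`, crux `CleanModels` (stmt-ResolutionOfSingularities-15917), line `Sketch` rev 35, stub 6 `stub_cleanProp44` (X44c):
# THE GENERIC TOWER — the two side conditions of STEP 1 at `η″` (`g(u) ≠ 0` are units; `𝔫_S ∩ κ[u][T] ≠ 0`) from the tower data

Seat decomp-res-hand-2 g23 (structural hand); complements ✓ `sigmaTower_successor_top` (`…SigmaTowerTop.lean`).  Along the tower of GENERIC points
(`c`, `ζ_0`, …, `ζ_{d}`, `η″`: the generic points of the σ-curves and of the near curve) the local rings `𝒪_{X_{j+1}, ζ_j}` are two-dimensional, `(t_j, v_j)`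
is a full regular system of parameters, and `D_j = 𝒪/(t_j, v_j)` is the residue FIELD `κ(Z_j) = κ(c)(u)`.  Then the two hypotheses `hCu`, `hne` of
✓ `sigmaTower_successor_top` are automatic:

* `le_nonZeroDivisors_of_isLocalization` — a localization structure `K → D` of a domain `K` with `D` non-trivial inverts no zero-divisor (`0 ∉ M₀`), so
  `K → D` is injective (`IsLocalization.injective`).
* `isUnit_of_base_residueField` — **`hCu`**: if `D_0 = A_0/𝔪_{A_0}` (the base ideal IS the maximal ideal) is a localization of the domain `K` at `M₀`, then for
  `g ≠ 0` every element `x = θ r₀` with `algebraMap g = r̄₀` (the compatibility clause of ✓ `sigmaTower`, `θ = ε ∘ Ψ_{d+1}`) is a unit.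
* `comap_maximalIdeal_ne_bot_of_isLocalization` — **`hne`**: a local ring `S` which is a localization of `R` at some submonoid and is NOT a field
  (`𝔫_S ≠ 0`: `η″` is a curve point of the surface `E`, `𝒪_{E,η″}` a discrete valuation ring) has `𝔫_S ∩ R ≠ 0`.

Honest framing: OURS, elementary; nothing here proves X44c, any case of `CleanModels`, or resolution of singularities in characteristic `p`.
[cite: Matsumura1987, Thm. 4.1–4.3] [cite: CossartPiltant2008, Lemma 4.3 (5); Prop. 4.4 (proof, p. 11)]
-/

set_option linter.dupNamespace false -- mandated namespace of this single-conjunct summit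

open IsLocalRing

namespace Summit.ResolutionOfSingularities.ResolutionOfSingularities.Theorems.RadicialJung.CleanModels

section Generic

/-- A localization structure `K → D` of a domain with `D` non-trivial has `M₀ ⊆` non-zero-divisors (i.e. `0 ∉ M₀`). [folklore] -/
theorem le_nonZeroDivisors_of_isLocalization {K : Type*} [CommRing K] [IsDomain K] (M₀ : Submonoid K) (D : Type*) [CommRing D]
    [Nontrivial D] [Algebra K D] [IsLocalization M₀ D] : M₀ ≤ nonZeroDivisors K := by
  intro m hm
  refine mem_nonZeroDivisors_of_ne_zero fun h0 => ?_
  subst h0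
  have hu := IsLocalization.map_units D ⟨(0 : K), hm⟩
  simp only [map_zero, isUnit_zero_iff] at hu
  exact zero_ne_one hu

/-- **`hCu` of ✓ `sigmaTower_successor_top` on the generic tower.**  `A₀` local with `I₀ = 𝔪_{A₀}` (the σ-curve's generic point: `(t_0, v_0)` is the whole
maximal ideal), `D_0 = A₀/I₀` a localization of the domain `K` at `M₀`, `θ : A₀ → E` any ring map; if `g ≠ 0` and `x = θ r₀` whenever `algebraMap g = r̄₀`,
then `x` is a unit. [folklore] -/
theorem isUnit_of_base_residueField {K : Type*} [CommRing K] [IsDomain K] {A₀ : Type*} [CommRing A₀] [IsLocalRing A₀] (I₀ : Ideal A₀)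
    (hI₀ : I₀ = maximalIdeal A₀) [Algebra K (A₀ ⧸ I₀)] (M₀ : Submonoid K) [IsLocalization M₀ (A₀ ⧸ I₀)]
    {E : Type*} [CommRing E] (θ : A₀ →+* E) {g : K} (hg : g ≠ 0) {x : E}
    (hx : ∀ r₀ : A₀, algebraMap K (A₀ ⧸ I₀) g = Ideal.Quotient.mk I₀ r₀ → x = θ r₀) : IsUnit x := by
  haveI : Nontrivial (A₀ ⧸ I₀) := Ideal.Quotient.nontrivial_iff.mpr (hI₀ ▸ (maximalIdeal.isMaximal A₀).ne_top)
  obtain ⟨r₀, hr₀⟩ := Ideal.Quotient.mk_surjective (algebraMap K (A₀ ⧸ I₀) g)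
  have hne : Ideal.Quotient.mk I₀ r₀ ≠ 0 := by
    rw [hr₀]
    intro h0
    apply hg
    exact IsLocalization.injective (A₀ ⧸ I₀) (le_nonZeroDivisors_of_isLocalization M₀ (A₀ ⧸ I₀)) (by rw [h0, map_zero])
  have hr₀𝔪 : r₀ ∉ maximalIdeal A₀ := by
    rw [← hI₀, ← Ideal.Quotient.eq_zero_iff_mem]; exact hne
  have hunit : IsUnit r₀ := by
    by_contra h
    exact hr₀𝔪 ((IsLocalRing.mem_maximalIdeal _).mpr h)
  rw [hx r₀ hr₀.symm]
  exact hunit.map θ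

/-- **`hne` of ✓ `sigmaTower_successor_top`.**  A local ring `S`, localization of `R` at some submonoid, whose maximal ideal is non-zero has
`𝔫_S ∩ R ≠ 0`: otherwise every non-zero element of `R` becomes a unit and every element of `S` (a fraction) is a unit or zero. [cite: Matsumura1987, Thm. 4.1–4.3] -/
theorem comap_maximalIdeal_ne_bot_of_isLocalization {R S : Type*} [CommRing R] [CommRing S] [IsLocalRing S] [Algebra R S]
    (N : Submonoid R) [IsLocalization N S] (hS : maximalIdeal S ≠ ⊥) :
    (maximalIdeal S).comap (algebraMap R S) ≠ ⊥ := by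
  intro h
  apply hS
  rw [eq_bot_iff]
  intro z hz
  obtain ⟨⟨a, n⟩, hz'⟩ := IsLocalization.surj N z
  have hn : IsUnit (algebraMap R S n) := IsLocalization.map_units S n
  by_cases ha : a = 0
  · -- `z · u = 0` with `u` a unit
    have h0 : z * algebraMap R S n = 0 := by rw [hz', ha, map_zero]
    rw [Ideal.mem_bot]
    obtain ⟨u, hu⟩ := hn
    have := congrArg (· * (↑u⁻¹ : S)) h0
    simpa [← hu, mul_assoc] using this
  · -- `a ∉ 𝔫_S ∩ R = 0`, so `algebraMap a` is a unit and `z` is a unit: contradiction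
    exfalso
    have ha' : a ∉ (maximalIdeal S).comap (algebraMap R S) := by rw [h]; exact ha
    rw [Ideal.mem_comap] at ha'
    have hua : IsUnit (algebraMap R S a) := by
      by_contra hu; exact ha' ((IsLocalRing.mem_maximalIdeal _).mpr hu)
    have hz_unit : IsUnit (z * algebraMap R S n) := by rw [hz']; exact hua
    exact (IsLocalRing.mem_maximalIdeal _).mp hz (isUnit_of_mul_isUnit_left hz_unit)

/-- The same with the hypothesis «`S` is not a field». [folklore] -/
theorem comap_maximalIdeal_ne_bot_of_not_isField {R S : Type*} [CommRing R] [CommRing S] [IsLocalRing S] [Algebra R S]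
    (N : Submonoid R) [IsLocalization N S] (hS : ¬ IsField S) : (maximalIdeal S).comap (algebraMap R S) ≠ ⊥ :=
  comap_maximalIdeal_ne_bot_of_isLocalization N fun h => hS (IsLocalRing.isField_iff_maximalIdeal_eq.mpr h)

/-- Existential form matching the `∃ N`-clause of ✓ `sigmaTower_top`. [folklore] -/
theorem comap_maximalIdeal_ne_bot_of_exists_isLocalization {R S : Type*} [CommRing R] [CommRing S] [IsLocalRing S] [Algebra R S]
    (hN : ∃ N : Submonoid R, IsLocalization N S) (hS : maximalIdeal S ≠ ⊥) : (maximalIdeal S).comap (algebraMap R S) ≠ ⊥ := by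
  obtain ⟨N, hN⟩ := hN
  exact comap_maximalIdeal_ne_bot_of_isLocalization N hS

end Generic

end Summit.ResolutionOfSingularities.ResolutionOfSingularities.Theorems.RadicialJung.CleanModels
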